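import Summits.ABC.StewartYu.MonomialDenominators
import Literature.NumberTheory.DiophantineGeometry.MultiplicativeGroupApproximationProofs
import Mathlib.Data.Rat.Lemmas
import HarnessLib

/-!
# Cell abc-stewartyu, Gen-3 frames (cruxes `Y07Odd`/`Y07Two`): the ALGEBRAIC VALUES at integer points —
# the cleared SUM over the box, its height, and Liouville at every prime (F1 "values II", Setup-free)

`Summits/ABC/StewartYu/GenThreeValuesSum.lean` — cell `abc-stewartyu` (HOME `run/shared/lean/pub/abc-stewartyu/`),
route `PadicPrimesKummerThird`, seat p4 (g3), engine-support seat; sequel of p3-g5's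
`MonomialDenominators.lean` (`MonomialDen.monDen`: ONE denominator clearing every monomial `∏ⱼ αⱼ^{eⱼ}` of
the signed box `|eⱼ| ≤ Eⱼ`, `|monDen·∏αᵉ| ≤ monDen²`, `log monDen ≤ 2∑Eⱼh(αⱼ)`).  Theorems only,
place-free except the last Liouville inequality (any prime).  Written against NO frame structure: the F1
layers of both frames instantiate it (p3-g5's `g3φ τ x`, the odd twin).

For integer coefficients `cᵢ` on a finite index set (unknowns × integer weights) and exponent rows `e i`
in the box, the value `φ = ∑ᵢ cᵢ·∏ⱼ αⱼ^{e i j}` satisfies: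
* `exists_int_monDen_mul_value` — `monDen·φ = Z ∈ ℤ`, `|Z| ≤ (∑|cᵢ|)·monDen²` (the Siegel-lemma row);
* `logHeight₁_intCast_div_natCast_le` — `h(Z/C) ≤ log max(|Z|, C)` (`Rat.num_dvd` / `Rat.den_dvd`);
* `logHeight₁_value_le` — **`h(φ) ≤ log max(1, ∑|cᵢ|) + 2·log monDen ≤ log max(1, ∑|cᵢ|) + 4·∑ⱼ Eⱼ·h(αⱼ)`**
  (common denominator; Mathlib's `Height.logHeight₁_sum_le` would charge the height of EVERY term);
* `padicValRat_value_mul_log_le` — Liouville: `φ ≠ 0 ⇒ ord_p(φ)·log p ≤` that bound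
  (`Dioph.padicValRat_mul_log_le_logHeight₁`);
* `sum_mul_logHeight₁_le_of_box` — Matveev-box bookkeeping `Eⱼ = Dⱼ·S`, `h(αⱼ) ≤ Vⱼ`, `Dⱼ·Vⱼ ≤ Λ`:
  `∑ⱼ Eⱼ·h(αⱼ) ≤ S·(n·Λ)`.

References: Yu. V. Nesterenko, LNM 1819 (2003), §3.2, §3.5 (3.37)–(3.40), §4.2; K. Yu, Acta Math. 211
(2013), Lemma 5.2.
-/

noncomputable section

open Finset
open Height
open Summit.ABC.StewartYu.MonomialDen

namespace Summit.ABC.StewartYu.GenThreeValues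

variable {n : ℕ}

/-! ### The cleared sum -/

/-- **Clearing the whole value**: for integer coefficients `cᵢ` on a finite index set and exponent rows
`e i` inside the box, `monDen · ∑ᵢ cᵢ ∏ⱼ αⱼ^{e i j} = Z ∈ ℤ` with `|Z| ≤ (∑ᵢ |cᵢ|)·monDen²`.
[cite: Nesterenko2003, §3.5 (3.38)–(3.40)] -/
theorem exists_int_monDen_mul_value {ι : Type*} (I : Finset ι) (α : Fin n → ℚ) (hα : ∀ j, α j ≠ 0)
    (E : Fin n → ℕ) (e : ι → Fin n → ℤ) (he : ∀ i ∈ I, ∀ j, |e i j| ≤ (E j : ℤ)) (c : ι → ℤ) :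
    ∃ Z : ℤ, ((monDen α E : ℕ) : ℚ) * ∑ i ∈ I, (c i : ℚ) * ∏ j, α j ^ e i j = Z ∧
      |Z| ≤ (∑ i ∈ I, |c i|) * (monDen α E : ℤ) ^ 2 := by
  classical
  have key : ∀ i ∈ I, ∃ z : ℤ, ((monDen α E : ℕ) : ℚ) * ∏ j, α j ^ e i j = z ∧
      |z| ≤ (monDen α E : ℤ) ^ 2 :=
    fun i hi => exists_int_monDen_mul_prod_zpow α hα E (e i) (he i hi)
  choose! z hz hzle using key
  refine ⟨∑ i ∈ I, c i * z i, ?_, ?_⟩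
  · rw [Finset.mul_sum, Int.cast_sum]
    refine Finset.sum_congr rfl fun i hi => ?_
    rw [Int.cast_mul, ← hz i hi]; ring
  · calc |∑ i ∈ I, c i * z i| ≤ ∑ i ∈ I, |c i * z i| := Finset.abs_sum_le_sum_abs _ _
      _ = ∑ i ∈ I, |c i| * |z i| := Finset.sum_congr rfl fun i _ => abs_mul _ _
      _ ≤ ∑ i ∈ I, |c i| * (monDen α E : ℤ) ^ 2 :=
          Finset.sum_le_sum fun i hi => mul_le_mul_of_nonneg_left (hzle i hi) (abs_nonneg _)
      _ = (∑ i ∈ I, |c i|) * (monDen α E : ℤ) ^ 2 := by rw [Finset.sum_mul]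

/-! ### Heights -/

/-- `h(Z / C) ≤ log max(|Z|, C)` for an integer `Z` and a natural number `C ≥ 1` (numerator and
denominator in lowest terms divide `Z` and `C`). [folklore] -/
theorem logHeight₁_intCast_div_natCast_le (Z : ℤ) {C : ℕ} (hC : 1 ≤ C) :
    logHeight₁ ((Z : ℚ) / C) ≤ Real.log (max (|Z| : ℝ) C) := by
  have hC0 : (C : ℤ) ≠ 0 := by exact_mod_cast (show C ≠ 0 by omega)
  rw [Rat.logHeight₁_eq_log_max]
  set q : ℚ := (Z : ℚ) / C with hq
  have hqdiv : q = Rat.divInt Z C := by rw [hq, Rat.divInt_eq_div]; push_cast; rfl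
  have hden : q.den ≤ C := by
    have h := Rat.den_dvd Z C
    rw [← hqdiv] at h
    exact Nat.le_of_dvd (by omega) (by exact_mod_cast h)
  have hmaxpos : (0 : ℝ) < ((max q.num.natAbs q.den : ℕ) : ℝ) := by
    exact_mod_cast lt_of_lt_of_le Nat.one_pos (le_max_of_le_right q.den_pos)
  refine Real.log_le_log hmaxpos ?_
  have hnum : q.num.natAbs ≤ Z.natAbs := by
    rcases eq_or_ne Z 0 with hZ | hZ
    · have hq0 : q = 0 := by rw [hq, hZ]; simp
      rw [hq0, hZ]; simp
    · have h := Rat.num_dvd Z hC0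
      rw [← hqdiv] at h
      exact Int.natAbs_le_of_dvd_ne_zero h hZ
  have h1 : ((max q.num.natAbs q.den : ℕ) : ℝ) ≤ ((max Z.natAbs C : ℕ) : ℝ) := by
    exact_mod_cast max_le_max hnum hden
  refine h1.trans (le_of_eq ?_)
  rw [Nat.cast_max, Nat.cast_natAbs, Int.cast_abs]

/-- **The height of a value**: `h(∑ᵢ cᵢ ∏ⱼ αⱼ^{e i j}) ≤ log max(1, ∑ᵢ|cᵢ|) + 2·log monDen` for integer
coefficients and exponent rows in the box. [cite: Nesterenko2003, §3.5 (3.40)] -/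
theorem logHeight₁_value_le_monDen {ι : Type*} (I : Finset ι) (α : Fin n → ℚ) (hα : ∀ j, α j ≠ 0)
    (E : Fin n → ℕ) (e : ι → Fin n → ℤ) (he : ∀ i ∈ I, ∀ j, |e i j| ≤ (E j : ℤ)) (c : ι → ℤ) :
    logHeight₁ (∑ i ∈ I, (c i : ℚ) * ∏ j, α j ^ e i j) ≤
      Real.log (max 1 ((∑ i ∈ I, |c i| : ℤ) : ℝ)) + 2 * Real.log (monDen α E : ℝ) := by
  classical
  obtain ⟨Z, hZ, hZle⟩ := exists_int_monDen_mul_value I α hα E e he c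
  have hC1 := one_le_monDen α hα E
  set C : ℕ := monDen α E with hCdef
  set v : ℚ := ∑ i ∈ I, (c i : ℚ) * ∏ j, α j ^ e i j with hvdef
  have hC0 : (C : ℚ) ≠ 0 := by exact_mod_cast (show C ≠ 0 by omega)
  have hCpos : (0 : ℝ) < (C : ℝ) := by exact_mod_cast (show 0 < C by omega)
  have hC1r : (1 : ℝ) ≤ (C : ℝ) := by exact_mod_cast hC1
  have hv : v = (Z : ℚ) / C := by
    rw [eq_div_iff hC0, mul_comm, hZ]
  rw [hv]
  refine (logHeight₁_intCast_div_natCast_le Z hC1).trans ?_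
  have hm1 : (1 : ℝ) ≤ max 1 ((∑ i ∈ I, |c i| : ℤ) : ℝ) := le_max_left _ _
  -- `max(|Z|, C) ≤ max(1, ∑|c|) · C²`
  have hmaxle : max (|Z| : ℝ) (C : ℝ) ≤ (max 1 ((∑ i ∈ I, |c i| : ℤ) : ℝ)) * (C : ℝ) ^ 2 := by
    refine max_le ?_ ?_
    · have h1 : (|Z| : ℝ) ≤ ((∑ i ∈ I, |c i| : ℤ) : ℝ) * (C : ℝ) ^ 2 := by
        have := (Int.cast_le (R := ℝ)).mpr hZle
        rw [Int.cast_mul, Int.cast_abs, Int.cast_pow] at this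
        rw [hCdef]; exact_mod_cast this
      exact h1.trans (mul_le_mul_of_nonneg_right (le_max_right _ _) (by positivity))
    · calc (C : ℝ) ≤ (C : ℝ) ^ 2 := by nlinarith
        _ = 1 * (C : ℝ) ^ 2 := (one_mul _).symm
        _ ≤ (max 1 ((∑ i ∈ I, |c i| : ℤ) : ℝ)) * (C : ℝ) ^ 2 :=
            mul_le_mul_of_nonneg_right hm1 (by positivity)
  have hpos : (0 : ℝ) < max (|Z| : ℝ) (C : ℝ) := lt_of_lt_of_le hCpos (le_max_right _ _)
  refine (Real.log_le_log hpos hmaxle).trans (le_of_eq ?_)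
  rw [Real.log_mul (by linarith) (by positivity), Real.log_pow]
  push_cast
  ring

/-- **The height of a value in terms of the generators' heights**:
`h(∑ᵢ cᵢ ∏ⱼ αⱼ^{e i j}) ≤ log max(1, ∑ᵢ|cᵢ|) + 4·∑ⱼ Eⱼ·h(αⱼ)`. [cite: Nesterenko2003, §3.5 (3.40)] -/
theorem logHeight₁_value_le {ι : Type*} (I : Finset ι) (α : Fin n → ℚ) (hα : ∀ j, α j ≠ 0)
    (E : Fin n → ℕ) (e : ι → Fin n → ℤ) (he : ∀ i ∈ I, ∀ j, |e i j| ≤ (E j : ℤ)) (c : ι → ℤ) :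
    logHeight₁ (∑ i ∈ I, (c i : ℚ) * ∏ j, α j ^ e i j) ≤
      Real.log (max 1 ((∑ i ∈ I, |c i| : ℤ) : ℝ)) + 4 * ∑ j, (E j : ℝ) * logHeight₁ (α j) := by
  have h1 := logHeight₁_value_le_monDen I α hα E e he c
  have h2 := log_monDen_le α hα E
  linarith

/-! ### Liouville, and the Matveev-box bookkeeping -/

/-- **Liouville at an integer point, any prime**: a NONZERO value satisfies
`ord_p(φ)·log p ≤ log max(1, ∑|cᵢ|) + 4·∑ⱼ Eⱼ·h(αⱼ)`. [cite: Nesterenko2003, §4.2; Yu2013, Lemma 5.2] -/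
theorem padicValRat_value_mul_log_le {ι : Type*} (I : Finset ι) (α : Fin n → ℚ) (hα : ∀ j, α j ≠ 0)
    (E : Fin n → ℕ) (e : ι → Fin n → ℤ) (he : ∀ i ∈ I, ∀ j, |e i j| ≤ (E j : ℤ)) (c : ι → ℤ)
    {p : ℕ} (hp : p.Prime) (hv : ∑ i ∈ I, (c i : ℚ) * ∏ j, α j ^ e i j ≠ 0) :
    (padicValRat p (∑ i ∈ I, (c i : ℚ) * ∏ j, α j ^ e i j) : ℝ) * Real.log p ≤
      Real.log (max 1 ((∑ i ∈ I, |c i| : ℤ) : ℝ)) + 4 * ∑ j, (E j : ℝ) * logHeight₁ (α j) :=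
  (Literature.NumberTheory.DiophantineGeometry.Dioph.padicValRat_mul_log_le_logHeight₁ p hp hv).trans
    (logHeight₁_value_le I α hα E e he c)

/-- **`p`-adic smallness forces vanishing** (the form the extrapolation uses): if the value is `≠ 0` its
`p`-adic valuation is bounded by the height budget, so a value with `ord_p(φ)·log p` BEYOND the budget is
`0`. [cite: Nesterenko2003, §4.2; Yu2013, Lemma 5.2] -/
theorem value_eq_zero_of_lt_padicValRat {ι : Type*} (I : Finset ι) (α : Fin n → ℚ) (hα : ∀ j, α j ≠ 0)
    (E : Fin n → ℕ) (e : ι → Fin n → ℤ) (he : ∀ i ∈ I, ∀ j, |e i j| ≤ (E j : ℤ)) (c : ι → ℤ)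
    {p : ℕ} (hp : p.Prime)
    (hbig : ∑ i ∈ I, (c i : ℚ) * ∏ j, α j ^ e i j ≠ 0 →
      Real.log (max 1 ((∑ i ∈ I, |c i| : ℤ) : ℝ)) + 4 * ∑ j, (E j : ℝ) * logHeight₁ (α j) <
        (padicValRat p (∑ i ∈ I, (c i : ℚ) * ∏ j, α j ^ e i j) : ℝ) * Real.log p) :
    ∑ i ∈ I, (c i : ℚ) * ∏ j, α j ^ e i j = 0 := by
  by_contra hv
  exact absurd (padicValRat_value_mul_log_le I α hα E e he c hp hv) (not_le.mpr (hbig hv))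

/-- **The Matveev box pays `n·Λ` per unit of `s`**: with `Eⱼ = Dⱼ·S`, `h(αⱼ) ≤ Vⱼ` and `Dⱼ·Vⱼ ≤ Λ`,
`∑ⱼ Eⱼ·h(αⱼ) ≤ S·(n·Λ)`. [cite: Nesterenko2003, §3.5 (3.40) with (3.5) `Dⱼ ≍ 1/Aⱼ`] -/
theorem sum_mul_logHeight₁_le_of_box (α : Fin n → ℚ) (V : Fin n → ℝ) (hV : ∀ j, logHeight₁ (α j) ≤ V j)
    (D : Fin n → ℕ) (S : ℕ) {Λ : ℝ} (hΛ : ∀ j, (D j : ℝ) * V j ≤ Λ) :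
    ∑ j, ((D j * S : ℕ) : ℝ) * logHeight₁ (α j) ≤ S * (n * Λ) := by
  have h1 : ∀ j, ((D j * S : ℕ) : ℝ) * logHeight₁ (α j) ≤ (S : ℝ) * Λ := by
    intro j
    have hh0 : 0 ≤ logHeight₁ (α j) := Height.zero_le_logHeight₁ _
    push_cast
    calc (D j : ℝ) * (S : ℝ) * logHeight₁ (α j) = (S : ℝ) * ((D j : ℝ) * logHeight₁ (α j)) := by ring
      _ ≤ (S : ℝ) * ((D j : ℝ) * V j) := by
          refine mul_le_mul_of_nonneg_left ?_ (Nat.cast_nonneg _)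
          exact mul_le_mul_of_nonneg_left (hV j) (Nat.cast_nonneg _)
      _ ≤ (S : ℝ) * Λ := mul_le_mul_of_nonneg_left (hΛ j) (Nat.cast_nonneg _)
  calc ∑ j, ((D j * S : ℕ) : ℝ) * logHeight₁ (α j) ≤ ∑ _j : Fin n, (S : ℝ) * Λ :=
        Finset.sum_le_sum fun j _ => h1 j
    _ = S * (n * Λ) := by
        rw [Finset.sum_const, Finset.card_univ, Fintype.card_fin, nsmul_eq_mul]; ring

end Summit.ABC.StewartYu.GenThreeValues

end
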